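import Summits.FinalStateConjecture.FinalStateConjecture.Theorems.PhotonSphereChannelsFrozenPacketAnsatz
import Summits.FinalStateConjecture.FinalStateConjecture.Theorems.PhotonSphereChannelsCauchyWave
import Summits.FinalStateConjecture.FinalStateConjecture.Theorems.PhotonSphereChannelsFrozenEscapeProfile

/-!
# Route PhotonSphereChannels — frozen velocity packets, II: both finite-time exterior energies are small

Support file for the refutation of K1 `UniformPhotonSphereChannels` (stmt-FinalStateConjecture-10045) and
the ex-falso settlement of K2 `ChannelsResolveTameDevelopments` (stmt-FinalStateConjecture-10046).

`frozen_escape`: photon sphere at the origin, `M = 1`, spin `s = 1`, any near edge `xe ≤ 0`, any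
`ε > 0`.  There are a mode `ℓ ≥ 1`, a layer `[α, β]`, `β < xe`, and a `C²` profile `g` supported in
it with `0 < ∫ g²`, such that EVERY global `C²` solution `ψ` of the spin-1 Regge–Wheeler equation with
data `(0, g)` vanishing outside the domain of influence of `[α, β]` has, at the time `T = 2w` and at
`−T`, two-ended exterior energy about the ball `(xe, −xe)` at most `ε ∫ g²`.

Mechanism (prover seat 3's frozen packet, `FrozenPacket.near_energy_le_at`): with `ℓ = n³`,
`w = n⁻²`, `α = xe − 2w`, `β = xe − w`, `g(x) = G(2(x − x₁)/w)`, `x₁ = xe − 3w/2`, and the frozen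
frequency `ω² = V(x₁) = ℓ(ℓ+1) f(x₁)`, the residual of the ansatz `g sin(ωt)/ω` is
`|(V − ω²)g − g''| ≤ ℓ(ℓ+1)·K w·A₀ + (2/w)²A₂ =: ωN` (Lipschitz bound of the shape `f` on the layer,
sup bounds of the bump), so the energy of `ψ` on `(−∞, α) = (−∞, xe − T)` at times `t ∈ [0, T]` is
`≤ (e − 1)T²(β − α)N² = O((ℓ² w⁴ + 1/(ℓ² w²)) · ∫ g²) = O(n⁻² ∫ g²)`; the far half-line carries
nothing by finite speed of propagation (`β + T ≤ −xe + T`); negative times by time reversal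
(`FrozenPacket.time_reverse`).  No semiclassical transport, no Kruskal frame.

No definitions. [folklore; mechanism = prover seat 3, `PhotonSphereChannelsFrozenPacketAnsatz.lean`]
-/

noncomputable section

open Set Filter MeasureTheory Topology Function
open scoped ENNReal

namespace Summit.FinalStateConjecture.FinalStateConjecture.Theorems.FrozenEscape

open Literature.Geometry.Lorentzian Literature.Geometry.Lorentzian.ReggeWheeler

/-! ### The budget: pure real arithmetic of the scaling `ℓ = n³`, `w = n⁻²` -/

/-- **The frozen-packet budget.**  With `L = n³(n³ + 1)`, `w = n⁻²`, `κ = 2/w`, layer width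
`β − α = w`, time `T = 2w`, frozen frequency `ω² = L·fx ≥ L·f₀` and residual size
`ωN = L K w A₀ + κ² A₂`, the bound `(e − 1) T² (β − α) N²` is at most `ε κ⁻¹ I` as soon as
`n² ≥ 128 (K²A₀² + 4A₂²)/(f₀ ε I)`. -/
theorem budget {K A₀ A₂ f₀ ε I n fx : ℝ} (hf₀ : 0 < f₀) (hε : 0 < ε) (hI : 0 < I) (hK : 0 ≤ K)
    (hA₀ : 0 ≤ A₀) (hA₂ : 0 ≤ A₂) (hn : 1 ≤ n) (hfx : f₀ ≤ fx)
    (hbig : 128 * (K ^ 2 * A₀ ^ 2 + 4 * A₂ ^ 2) / (f₀ * ε * I) ≤ n ^ 2) :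
    (Real.exp 1 - 1) * (2 * (1 / n ^ 2)) ^ 2 * ((1 / n ^ 2) *
      ((n ^ 3 * (n ^ 3 + 1) * K * (1 / n ^ 2) * A₀ + (2 / (1 / n ^ 2)) ^ 2 * A₂)
        / Real.sqrt (n ^ 3 * (n ^ 3 + 1) * fx)) ^ 2)
      ≤ ε * ((2 / (1 / n ^ 2))⁻¹ * I) := by
  have hn0 : 0 < n := by linarith
  have hn2 : 0 < n ^ 2 := by positivity
  have hfx0 : 0 < fx := lt_of_lt_of_le hf₀ hfx
  set L : ℝ := n ^ 3 * (n ^ 3 + 1) with hL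
  have hL0 : 0 < L := by positivity
  have hLle : L ≤ 2 * n ^ 6 := by
    have : n ^ 3 * 1 ≤ n ^ 3 * n ^ 3 := by
      apply mul_le_mul_of_nonneg_left _ (by positivity)
      exact one_le_pow₀ hn
    nlinarith
  have hLge : n ^ 6 ≤ L := by
    have : n ^ 3 * n ^ 3 ≤ n ^ 3 * (n ^ 3 + 1) := by
      apply mul_le_mul_of_nonneg_left (by linarith) (by positivity)
    nlinarith
  -- simplify the scale expressions
  have hw : (1 : ℝ) / n ^ 2 = (n ^ 2)⁻¹ := one_div _
  have hκ : (2 : ℝ) / (1 / n ^ 2) = 2 * n ^ 2 := by field_simp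
  rw [hκ]
  have hκinv : (2 * n ^ 2 : ℝ)⁻¹ * I = I / (2 * n ^ 2) := by
    rw [inv_mul_eq_div]
  rw [hκinv]
  -- the residual numerator P + Q
  set P : ℝ := L * K * (1 / n ^ 2) * A₀ with hP
  set Q : ℝ := (2 * n ^ 2) ^ 2 * A₂ with hQ
  have hP0 : 0 ≤ P := by positivity
  have hQ0 : 0 ≤ Q := by positivity
  have hPle : P ^ 2 ≤ 4 * n ^ 8 * K ^ 2 * A₀ ^ 2 := by
    have h1 : P = L * (1 / n ^ 2) * (K * A₀) := by rw [hP]; ring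
    have h2 : L * (1 / n ^ 2) ≤ 2 * n ^ 4 := by
      rw [div_eq_mul_inv, one_mul]
      calc L * (n ^ 2)⁻¹ ≤ 2 * n ^ 6 * (n ^ 2)⁻¹ := by gcongr
        _ = 2 * n ^ 4 := by field_simp
    have h3 : 0 ≤ L * (1 / n ^ 2) := by positivity
    have h4 : (L * (1 / n ^ 2)) ^ 2 ≤ (2 * n ^ 4) ^ 2 := pow_le_pow_left₀ h3 h2 2
    rw [h1, mul_pow]
    have hKA : 0 ≤ (K * A₀) ^ 2 := sq_nonneg _
    calc (L * (1 / n ^ 2)) ^ 2 * (K * A₀) ^ 2 ≤ (2 * n ^ 4) ^ 2 * (K * A₀) ^ 2 :=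
          mul_le_mul_of_nonneg_right h4 hKA
      _ = 4 * n ^ 8 * K ^ 2 * A₀ ^ 2 := by ring
  have hQeq : Q ^ 2 = 16 * n ^ 8 * A₂ ^ 2 := by rw [hQ]; ring
  -- the frozen frequency
  have hS0 : 0 < L * fx := mul_pos hL0 hfx0
  have hsqrt : Real.sqrt (L * fx) ^ 2 = L * fx := Real.sq_sqrt hS0.le
  have hSge : n ^ 6 * f₀ ≤ L * fx := mul_le_mul hLge hfx hf₀.le hL0.le
  have hS6 : 0 < n ^ 6 * f₀ := by positivity
  -- N² ≤ n² (8K²A₀² + 32A₂²)/f₀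
  have hN : ((P + Q) / Real.sqrt (L * fx)) ^ 2 ≤ n ^ 2 * (8 * K ^ 2 * A₀ ^ 2 + 32 * A₂ ^ 2) / f₀ := by
    rw [div_pow, hsqrt]
    have hnum : (P + Q) ^ 2 ≤ 2 * P ^ 2 + 2 * Q ^ 2 := by nlinarith [sq_nonneg (P - Q)]
    have hnum' : (P + Q) ^ 2 ≤ n ^ 8 * (8 * K ^ 2 * A₀ ^ 2 + 32 * A₂ ^ 2) := by
      calc (P + Q) ^ 2 ≤ 2 * P ^ 2 + 2 * Q ^ 2 := hnum
        _ ≤ 2 * (4 * n ^ 8 * K ^ 2 * A₀ ^ 2) + 2 * (16 * n ^ 8 * A₂ ^ 2) := by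
            rw [hQeq]; linarith
        _ = n ^ 8 * (8 * K ^ 2 * A₀ ^ 2 + 32 * A₂ ^ 2) := by ring
    calc (P + Q) ^ 2 / (L * fx) ≤ n ^ 8 * (8 * K ^ 2 * A₀ ^ 2 + 32 * A₂ ^ 2) / (n ^ 6 * f₀) := by
          gcongr
      _ = n ^ 2 * (8 * K ^ 2 * A₀ ^ 2 + 32 * A₂ ^ 2) / f₀ := by
          field_simp
  -- (e − 1) ≤ 2
  have he : Real.exp 1 - 1 ≤ 2 := by
    have := Real.exp_one_lt_d9
    linarith
  have he0 : 0 ≤ Real.exp 1 - 1 := by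
    have := Real.add_one_le_exp (1 : ℝ)
    linarith
  -- assemble the left-hand side
  have hB : (Real.exp 1 - 1) * (2 * (1 / n ^ 2)) ^ 2 * ((1 / n ^ 2) *
      ((P + Q) / Real.sqrt (L * fx)) ^ 2)
        ≤ 2 * (2 * (1 / n ^ 2)) ^ 2 * ((1 / n ^ 2) *
          (n ^ 2 * (8 * K ^ 2 * A₀ ^ 2 + 32 * A₂ ^ 2) / f₀)) := by
    have h1 : 0 ≤ (2 * (1 / n ^ 2)) ^ 2 := sq_nonneg _
    have h2 : 0 ≤ (1 : ℝ) / n ^ 2 := by positivity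
    have h3 : 0 ≤ ((P + Q) / Real.sqrt (L * fx)) ^ 2 := sq_nonneg _
    gcongr
  have hB' : 2 * (2 * (1 / n ^ 2)) ^ 2 * ((1 / n ^ 2) *
      (n ^ 2 * (8 * K ^ 2 * A₀ ^ 2 + 32 * A₂ ^ 2) / f₀))
        = 64 * (K ^ 2 * A₀ ^ 2 + 4 * A₂ ^ 2) / (f₀ * n ^ 4) := by
    field_simp
    ring
  -- the choice of n
  have hfin : 64 * (K ^ 2 * A₀ ^ 2 + 4 * A₂ ^ 2) / (f₀ * n ^ 4) ≤ ε * (I / (2 * n ^ 2)) := by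
    have hden : 0 < f₀ * ε * I := by positivity
    have hbig' : 128 * (K ^ 2 * A₀ ^ 2 + 4 * A₂ ^ 2) ≤ n ^ 2 * (f₀ * ε * I) := by
      have := (div_le_iff₀ hden).1 hbig
      linarith
    rw [div_le_iff₀ (by positivity)]
    have h4 : ε * (I / (2 * n ^ 2)) * (f₀ * n ^ 4) = n ^ 2 * (f₀ * ε * I) / 2 := by
      field_simp
    rw [h4]
    linarith [hbig']
  calc _ ≤ _ := hB
    _ = _ := hB'
    _ ≤ _ := hfin

/-! ### The escape theorem -/

/-- **Frozen velocity packets escape both near channels (and never reach the far one).**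
Photon sphere at the origin, `M = 1`, `s = 1`, near edge `xe ≤ 0`: for every `ε > 0` there are
`ℓ ≥ 1`, a layer `[α, β]` with `β < xe`, and a `C²` profile `g` supported in `[α, β]`, `0 < ∫ g²`,
such that every global `C²` spin-1 Regge–Wheeler solution with data `(0, g)` vanishing outside the
domain of influence of `[α, β]` has two-ended exterior energy about `(xe, −xe)` at most `ε ∫ g²` at
some time `T ≥ 0` and at `−T`. -/
theorem frozen_escape_of {r : ℝ → ℝ} (hr : IsTortoiseRadius 1 r 0) (xe : ℝ) (hxe : xe ≤ 0)
    {ε : ℝ} (hε : 0 < ε) :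
    ∃ (ℓ : ℕ) (α β : ℝ) (g : ℝ → ℝ), 1 ≤ ℓ ∧ α < β ∧ β < xe ∧ ContDiff ℝ 2 g ∧
      (∀ x, x ≤ α ∨ β ≤ x → g x = 0) ∧ Integrable (fun x => g x ^ 2) ∧ 0 < ∫ x, g x ^ 2 ∧
      ∀ ψ : ℝ → ℝ → ℝ, IsRWSolution 1 1 ℓ r ψ → (∀ x, ψ 0 x = 0) →
        (∀ x, deriv (fun τ => ψ τ x) 0 = g x) →
        (∀ t x, (x + |t| ≤ α ∨ β + |t| ≤ x) → ψ t x = 0) →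
        ∃ T : ℝ, 0 ≤ T ∧
          exteriorEnergy (linePotential 1 1 ℓ r) 0 (-xe) ψ T ≤ ENNReal.ofReal (ε * ∫ x, g x ^ 2) ∧
          exteriorEnergy (linePotential 1 1 ℓ r) 0 (-xe) ψ (-T)
            ≤ ENNReal.ofReal (ε * ∫ x, g x ^ 2) := by
  -- the unit bump and the shape of the potential on the layer [xe − 1, xe]
  obtain ⟨G, hG2, hG0, ⟨A₀, hA₀0, hA₀⟩, ⟨A₂, hA₂0, hA₂⟩, hGi, hGpos⟩ := exists_unit_bump
  set I : ℝ := ∫ x, G x ^ 2 with hI_def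
  obtain ⟨f₀, K, hf₀, hK, hfloor, hlip⟩ :=
    shape_layer_bounds_of hr (a := xe - 1) (b := xe) (by linarith)
  -- the scale n
  obtain ⟨n, hn⟩ := exists_nat_ge (max 2 (128 * (K ^ 2 * A₀ ^ 2 + 4 * A₂ ^ 2) / (f₀ * ε * I)))
  have hn2 : (2 : ℝ) ≤ n := le_trans (le_max_left _ _) hn
  have hn1 : (1 : ℝ) ≤ n := by linarith
  have hnpos : (0 : ℝ) < n := by linarith
  have hbig : 128 * (K ^ 2 * A₀ ^ 2 + 4 * A₂ ^ 2) / (f₀ * ε * I) ≤ (n : ℝ) ^ 2 := by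
    refine le_trans (le_max_right _ _) (hn.trans ?_)
    have : (n : ℝ) * 1 ≤ (n : ℝ) * n := mul_le_mul_of_nonneg_left hn1 hnpos.le
    nlinarith
  -- parameters
  set w : ℝ := 1 / (n : ℝ) ^ 2 with hw_def
  have hw0 : 0 < w := by positivity
  have hw4 : w ≤ 1 / 4 := by
    rw [hw_def]
    apply div_le_div_of_nonneg_left zero_le_one (by norm_num)
    nlinarith
  set κ : ℝ := 2 / w with hκ_def
  have hκ0 : 0 < κ := by positivity
  have hκinv : κ⁻¹ = w / 2 := by rw [hκ_def, inv_div]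
  set x₁ : ℝ := xe - 3 * w / 2 with hx₁_def
  set α : ℝ := xe - 2 * w with hα_def
  set β : ℝ := xe - w with hβ_def
  set T : ℝ := 2 * w with hT_def
  have hT0 : 0 < T := by positivity
  have hαβ : α < β := by rw [hα_def, hβ_def]; linarith
  have hβxe : β < xe := by rw [hβ_def]; linarith
  set ℓ : ℕ := n ^ 3 with hℓ_def
  have hℓ1 : 1 ≤ ℓ := by
    have h1 : 1 ≤ n := by exact_mod_cast hn1
    exact Nat.one_le_pow _ _ h1
  have hℓR : (ℓ : ℝ) = (n : ℝ) ^ 3 := by rw [hℓ_def]; push_cast; ring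
  set L : ℝ := (ℓ : ℝ) * ((ℓ : ℝ) + 1) with hL_def
  have hLn : L = (n : ℝ) ^ 3 * ((n : ℝ) ^ 3 + 1) := by rw [hL_def, hℓR]
  have hL0 : 0 ≤ L := by positivity
  -- the profile
  obtain ⟨hgC, hgsupp, hgne, hgA₀, hgA₂, hgi, hgval⟩ := scaled_profile hG2 hG0 hA₀ hA₂ x₁ hκ0
  set g : ℝ → ℝ := fun x => G (κ * (x - x₁)) with hg_def
  have hgsupp' : ∀ x, x ≤ α ∨ β ≤ x → g x = 0 := by
    intro x hx
    apply hgsupp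
    rw [hκinv]
    rcases hx with h | h
    · left; rw [hα_def] at h; rw [hx₁_def]; linarith
    · right; rw [hβ_def] at h; rw [hx₁_def]; linarith
  have hgpos : 0 < ∫ x, g x ^ 2 := by
    show 0 < ∫ x, G (κ * (x - x₁)) ^ 2
    rw [hgval]
    exact mul_pos (inv_pos.2 hκ0) hGpos
  refine ⟨ℓ, α, β, g, hℓ1, hαβ, hβxe, hgC, hgsupp', hgi, hgpos, fun ψ hψ hψ0 hψ1 hψsupp => ?_⟩
  -- the potential
  set V : ℝ → ℝ := linePotential 1 1 ℓ r with hV_def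
  have hV1 : ContDiff ℝ 1 V := CauchyWave.contDiff_one_linePotential hr 1 ℓ
  have hVnn : ∀ x, 0 ≤ V x := fun x => linePotential_nonneg zero_le_one hℓ1 hr.two_mul_lt x
  have hVf : ∀ x, V x = L * ((1 - 2 / r x) / r x ^ 2) := fun x => by
    rw [hV_def, hL_def]; exact linePotential_one_one_eq r ℓ x
  -- the frozen frequency
  have hx₁mem : x₁ ∈ Icc (xe - 1) xe := by
    rw [hx₁_def]; constructor <;> linarith
  set fx : ℝ := (1 - 2 / r x₁) / r x₁ ^ 2 with hfx_def
  have hfx : f₀ ≤ fx := hfloor x₁ hx₁mem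
  have hfx0 : 0 < fx := lt_of_lt_of_le hf₀ hfx
  have hLpos : 0 < L := by rw [hLn]; positivity
  set ω : ℝ := Real.sqrt (L * fx) with hω_def
  have hω0 : 0 < ω := Real.sqrt_pos.2 (mul_pos hLpos hfx0)
  have hω2 : ω ^ 2 = L * fx := Real.sq_sqrt (mul_pos hLpos hfx0).le
  -- the residual bound
  set N : ℝ := (L * K * w * A₀ + κ ^ 2 * A₂) / ω with hN_def
  have hωN : ω * N = L * K * w * A₀ + κ ^ 2 * A₂ := by
    rw [hN_def]; field_simp
  have hres : ∀ x, |(V x - ω ^ 2) * g x - iteratedDeriv 2 g x| ≤ ω * N := by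
    intro x
    rw [hωN]
    have h1 : |(V x - ω ^ 2) * g x| ≤ L * K * w * A₀ := by
      by_cases hgx : g x = 0
      · rw [hgx, mul_zero, abs_zero]; positivity
      · have hnear := hgne x hgx
        rw [hκinv] at hnear
        have hxmem : x ∈ Icc (xe - 1) xe := by
          rw [abs_lt] at hnear
          rw [hx₁_def] at hnear
          constructor <;> linarith
        have hdiff : |V x - ω ^ 2| ≤ L * K * w := by
          rw [hω2, hVf x, ← mul_sub, abs_mul, abs_of_nonneg hL0]
          have h2 := hlip x hxmem x₁ hx₁mem
          have h3 : K * |x - x₁| ≤ K * w :=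
            mul_le_mul_of_nonneg_left (by linarith [hnear.le]) hK
          calc L * |(1 - 2 / r x) / r x ^ 2 - fx| ≤ L * (K * |x - x₁|) :=
                mul_le_mul_of_nonneg_left h2 hL0
            _ ≤ L * (K * w) := mul_le_mul_of_nonneg_left h3 hL0
            _ = L * K * w := by ring
        rw [abs_mul]
        have h4 : 0 ≤ L * K * w := by positivity
        exact mul_le_mul hdiff (hgA₀ x) (abs_nonneg _) h4
    have h2 : |iteratedDeriv 2 g x| ≤ κ ^ 2 * A₂ := hgA₂ x
    exact (abs_sub _ _).trans (add_le_add h1 h2)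
  -- the budget
  have hbudget : (Real.exp 1 - 1) * T ^ 2 * ((β - α) * N ^ 2) ≤ ε * ∫ x, g x ^ 2 := by
    have hval : ∫ x, g x ^ 2 = κ⁻¹ * I := hgval
    rw [hval]
    have hβα : β - α = w := by rw [hα_def, hβ_def]; ring
    rw [hβα, hT_def, hN_def, hω_def, hκ_def, hw_def, hLn]
    exact budget hf₀ hε hGpos hK hA₀0 hA₂0 hn1 hfx hbig
  -- the solution: regularity, equation, support in open form
  have hψ2 : ContDiff ℝ 2 (uncurry ψ) := hψ.1
  have hsol : ∀ t x, iteratedDeriv 2 (fun τ => ψ τ x) t - iteratedDeriv 2 (ψ t) x + V x * ψ t x = 0 :=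
    fun t x => hψ.2 (t, x)
  have hsupp : ∀ t x, (x < α - |t| ∨ β + |t| < x) → ψ t x = 0 := by
    intro t x hx
    apply hψsupp
    rcases hx with h | h
    · left; linarith
    · right; linarith
  have hg0 : ∀ x, (x < α ∨ β < x) → g x = 0 := fun x hx =>
    hgsupp' x (hx.elim (fun h => Or.inl h.le) (fun h => Or.inr h.le))
  -- geometry of the exterior set at times ±T
  have hsub : ∀ s : ℝ, |s| = T → {x : ℝ | -xe + |s| < |x - 0|} ⊆ Iio α ∪ Ioi (β + |s|) := by
    intro s hs x hx
    rw [mem_setOf_eq, sub_zero, hs] at hx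
    rw [hs]
    by_cases hx0 : x < 0
    · left
      rw [abs_of_neg hx0] at hx
      rw [mem_Iio, hα_def]
      linarith
    · right
      rw [not_lt] at hx0
      rw [abs_of_nonneg hx0] at hx
      rw [mem_Ioi, hβ_def]
      linarith
  -- the exterior energy at a time s with |s| = T is at most the near energy on (−∞, α)
  have hext : ∀ s : ℝ, |s| = T →
      exteriorEnergy V 0 (-xe) ψ s ≤ ENNReal.ofReal (∫ x in Iio α, energyDensity V ψ s x) := by
    intro s hs
    have hint : Integrable (fun x => energyDensity V ψ s x) :=
      FrozenPacket.integrable_energyDensity hV1.continuous hψ2 hsupp s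
    have hzero : ∀ x ∈ Ioi (β + |s|), ENNReal.ofReal (energyDensity V ψ s x) = 0 := by
      intro x hx
      rw [mem_Ioi] at hx
      have h := FrozenPacket.energyDensity_eq_zero_of_exterior (V := V) hψ2 hsupp (s := s) (x := x)
        (Or.inr hx)
      unfold energyDensity
      rw [h, ENNReal.ofReal_zero]
    unfold exteriorEnergy
    calc ∫⁻ x in {x : ℝ | -xe + |s| < |x - 0|}, ENNReal.ofReal (energyDensity V ψ s x)
        ≤ ∫⁻ x in Iio α ∪ Ioi (β + |s|), ENNReal.ofReal (energyDensity V ψ s x) :=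
          lintegral_mono_set (hsub s hs)
      _ ≤ (∫⁻ x in Iio α, ENNReal.ofReal (energyDensity V ψ s x))
            + ∫⁻ x in Ioi (β + |s|), ENNReal.ofReal (energyDensity V ψ s x) :=
          lintegral_union_le _ _ _
      _ = (∫⁻ x in Iio α, ENNReal.ofReal (energyDensity V ψ s x)) + 0 := by
          congr 1
          rw [setLIntegral_congr_fun measurableSet_Ioi hzero, lintegral_zero]
      _ = ENNReal.ofReal (∫ x in Iio α, energyDensity V ψ s x) := by
          rw [add_zero]
          exact (ofReal_integral_eq_lintegral_ofReal hint.integrableOn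
            (ae_of_all _ fun x => energyDensity_nonneg ψ s (hVnn x))).symm
  refine ⟨T, hT0.le, ?_, ?_⟩
  · -- positive time
    have hnear := FrozenPacket.near_energy_le_at hV1 hVnn hψ2 hsol hsupp hψ0 hψ1 hgC hg0 hαβ.le
      hω0 hT0 hres T ⟨hT0.le, le_rfl⟩
    refine (hext T (abs_of_pos hT0)).trans (ENNReal.ofReal_le_ofReal (le_trans ?_ hbudget))
    exact hnear
  · -- negative time, by time reversal
    obtain ⟨hm2, hmsol, hmsupp, hm0, hm1, hme⟩ := FrozenPacket.time_reverse hψ2 hsol hsupp hψ0 hψ1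
    have hgC' : ContDiff ℝ 2 (fun x => -g x) := hgC.neg
    have hg0' : ∀ x, (x < α ∨ β < x) → (fun x => -g x) x = 0 := fun x hx => by
      simp [hg0 x hx]
    have hres' : ∀ x, |(V x - ω ^ 2) * (fun x => -g x) x - iteratedDeriv 2 (fun x => -g x) x|
        ≤ ω * N := by
      intro x
      have h1 : iteratedDeriv 2 (fun x => -g x) x = -iteratedDeriv 2 g x :=
        iteratedDeriv_fun_neg 2 g x
      rw [h1]
      have h2 : (V x - ω ^ 2) * (fun x => -g x) x - -iteratedDeriv 2 g x
          = -((V x - ω ^ 2) * g x - iteratedDeriv 2 g x) := by simp only; ring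
      rw [h2, abs_neg]
      exact hres x
    have hnear := FrozenPacket.near_energy_le_at hV1 hVnn hm2 hmsol hmsupp hm0 hm1 hgC' hg0'
      hαβ.le hω0 hT0 hres' T ⟨hT0.le, le_rfl⟩
    have heq : (∫ x in Iio α, energyDensity V ψ (-T) x)
        = ∫ x in Iio α, (deriv (fun τ => (fun s y => ψ (-s) y) τ x) T ^ 2
          + deriv ((fun s y => ψ (-s) y) T) x ^ 2 + V x * (fun s y => ψ (-s) y) T x ^ 2) := by
      refine integral_congr_ae (ae_of_all _ fun x => ?_)
      unfold energyDensity
      exact (hme T x).symm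
    refine (hext (-T) (by rw [abs_neg, abs_of_pos hT0])).trans
      (ENNReal.ofReal_le_ofReal (le_trans ?_ hbudget))
    rw [heq]
    exact hnear

/-- **Registered sub-goal `frozen_escape`** (item stmt-FinalStateConjecture-10046, prover seat 0; statement
verbatim as registered): frozen velocity packets escape both near channels at `±T`. -/
theorem frozen_escape : ∀ {r : ℝ → ℝ}, Literature.Geometry.Lorentzian.ReggeWheeler.IsTortoiseRadius 1 r 0 → ∀ xe : ℝ, xe ≤ 0 → ∀ {ε : ℝ}, 0 < ε → ∃ (ℓ : ℕ) (α β : ℝ) (g : ℝ → ℝ), 1 ≤ ℓ ∧ α < β ∧ β < xe ∧ ContDiff ℝ 2 g ∧ (∀ x, x ≤ α ∨ β ≤ x → g x = 0) ∧ MeasureTheory.Integrable (fun x => g x ^ 2) ∧ 0 < ∫ x, g x ^ 2 ∧ ∀ ψ : ℝ → ℝ → ℝ, Literature.Geometry.Lorentzian.ReggeWheeler.IsRWSolution 1 1 ℓ r ψ → (∀ x, ψ 0 x = 0) → (∀ x, deriv (fun τ => ψ τ x) 0 = g x) → (∀ t x, (x + |t| ≤ α ∨ β + |t| ≤ x) →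 ψ t x = 0) → ∃ T : ℝ, 0 ≤ T ∧ Literature.Geometry.Lorentzian.ReggeWheeler.exteriorEnergy (Literature.Geometry.Lorentzian.ReggeWheeler.linePotential 1 1 ℓ r) 0 (-xe) ψ T ≤ ENNReal.ofReal (ε * ∫ x, g x ^ 2) ∧ Literature.Geometry.Lorentzian.ReggeWheeler.exteriorEnergy (Literature.Geometry.Lorentzian.ReggeWheeler.linePotential 1 1 ℓ r) 0 (-xe) ψ (-T) ≤ ENNReal.ofReal (ε * ∫ x, g x ^ 2) :=
  fun hr xe hxe _ hε => frozen_escape_of hr xe hxe hε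

end Summit.FinalStateConjecture.FinalStateConjecture.Theorems.FrozenEscape

end
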